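import Mathlib
import Summits.Ventures.HodgeRepro2.T5IsotypicHom

/-!
# Submodules of products of copies of a finite-dimensional simple module are semisimple isotypic
# (the `K`-level heart of MVW chap. 2, III.3–III.5)

Blind cell `pub-hodge-repro2`, seat p8 (gen 5), Tier-5 kernel support.  `T5IsotypicHom`
(p392230) shows that a SEMISIMPLE module ISOTYPIC of type `N` is `N ⊗ Hom(N, ·)`.  The record
(route/T5-N3-route-2.md §N3.10.3; MVW chap. 2 III.5) applies this to `S[π₁] = S / S(π₁)`,
`S(π₁) = ⋂ Ker f` over `f ∈ Hom_{G₁}(S, π₁)`, and MVW's proof that `S[π₁]` is semisimple and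
`π₁`-isotypic runs through the `K`-invariants: `S[π₁]^K ↪ ∏ π₁^K` with `π₁^K` finite-dimensional
and simple over the Hecke algebra.  This file kernel-checks that `K`-level heart:

* `N ⊗[k] (I → k) ≃ₗ[R] (I → N)` for a FINITE-DIMENSIONAL `k`-space `N` with an `R`-action
  (`piEquiv`; `n ⊗ f ↦ (i ↦ f i • n)`, inverse by coordinates in a basis), for ANY index set `I`;
* `N ⊗[k] W ≃ₗ[R] (B →₀ N)` for a basis `B` of `W` (`tensorFinsuppEquiv`), and `ι →₀ N` is
  semisimple and isotypic of type `N` when `N` is simple (`isSemisimpleModule_finsupp`,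
  `isIsotypicOfType_finsupp`);
* hence every `R`-submodule of a product `I → N` of copies of a finite-dimensional simple `N` is
  semisimple and isotypic of type `N` (`isSemisimpleModule_of_le_pi`, `isIsotypicOfType_of_le_pi`);
* the quotient `S[N] := S ⧸ ⨅_{f : S →ₗ[R] N} Ker f` embeds into `Hom_R(S, N) → N`
  (`quotEmbed_injective`), so it is semisimple and `N`-isotypic
  (`isSemisimpleModule_isotypicQuot`, `isIsotypicOfType_isotypicQuot`), and therefore
  `S[N] ≃ₗ[R] N ⊗[k] Hom_R(N, S[N])` by `T5IsotypicHom.evEquiv` (`isotypicQuotEquiv`) —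
  MVW III.3 + III.5 for a finite-dimensional simple `N` with `End_R(N) = k`.

What stays prose: the passage from the `K`-level (`π₁^K` finite-dimensional over the Hecke
algebra `H(G₁, K)`) to the smooth representation `π₁` itself (MVW's argument / Bernstein's
equivalence), and the identification of the objects.

README §8(d): uses an L-value-free non-vanishing device: NO.
-/

noncomputable section

namespace Summit.Ventures.HodgeRepro2.T5IsotypicProduct

open TensorProduct

variable {k R N : Type*} [Field k] [Ring R] [Algebra k R] [AddCommGroup N] [Module R N]
  [Module k N] [IsScalarTower k R N]

section Finsupp

variable {ι : Type*}

omit [Field k] [Algebra k R] [Module k N] [IsScalarTower k R N] in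
/-- The range of `lsingle i : N → (ι →₀ N)` is a copy of `N`. -/
def rangeLsingleEquiv (i : ι) :
    N ≃ₗ[R] LinearMap.range (Finsupp.lsingle i : N →ₗ[R] (ι →₀ N)) :=
  LinearEquiv.ofInjective _ (LinearMap.ker_eq_bot.mp (Finsupp.ker_lsingle i))

omit [Field k] [Algebra k R] [Module k N] [IsScalarTower k R N] in
/-- `ι →₀ N` is semisimple when `N` is simple (a direct sum of copies of `N`). -/
theorem isSemisimpleModule_finsupp [IsSimpleModule R N] : IsSemisimpleModule R (ι →₀ N) :=
  isSemisimpleModule_of_isSemisimpleModule_submodule'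
    (p := fun i => LinearMap.range (Finsupp.lsingle i : N →ₗ[R] (ι →₀ N)))
    (fun i => by
      haveI : IsSimpleModule R (LinearMap.range (Finsupp.lsingle i : N →ₗ[R] (ι →₀ N))) :=
        IsSimpleModule.congr (rangeLsingleEquiv i).symm
      infer_instance)
    Finsupp.iSup_lsingle_range

omit [Field k] [Algebra k R] [Module k N] [IsScalarTower k R N] in
/-- `ι →₀ N` is isotypic of type `N` when `N` is simple: every simple submodule is a copy of
`N`. -/
theorem isIsotypicOfType_finsupp [IsSimpleModule R N] : IsIsotypicOfType R (ι →₀ N) N := by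
  intro m hm
  have hs : m ≤ sSup (Set.range fun i =>
      LinearMap.range (Finsupp.lsingle i : N →ₗ[R] (ι →₀ N))) := by
    rw [sSup_range, Finsupp.iSup_lsingle_range]
    exact le_top
  haveI : ∀ S : Set.range (fun i =>
      LinearMap.range (Finsupp.lsingle i : N →ₗ[R] (ι →₀ N))), IsSimpleModule R S := by
    rintro ⟨S, i, rfl⟩
    exact IsSimpleModule.congr (rangeLsingleEquiv i).symm
  obtain ⟨S, ⟨i, rfl⟩, ⟨e⟩⟩ := Submodule.linearEquiv_of_le_sSup m _ hs
  exact ⟨e.trans (rangeLsingleEquiv i).symm⟩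

end Finsupp

section Pi

variable {I : Type*}

/-- `n ↦ (f ↦ (i ↦ f i • n))`, `R`-linear in `n`. -/
def piBilin : N →ₗ[R] ((I → k) →ₗ[k] (I → N)) where
  toFun n :=
    { toFun := fun f i => f i • n
      map_add' := fun f g => by
        ext i
        simp only [Pi.add_apply, add_smul]
      map_smul' := fun c f => by
        ext i
        simp only [Pi.smul_apply, smul_eq_mul, RingHom.id_apply, mul_smul] }
  map_add' n n' := by
    ext f i
    simp only [LinearMap.coe_mk, AddHom.coe_mk, LinearMap.add_apply, Pi.add_apply, smul_add]
  map_smul' r n := by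
    ext f i
    simp only [LinearMap.coe_mk, AddHom.coe_mk, LinearMap.smul_apply, Pi.smul_apply,
      RingHom.id_apply]
    exact smul_comm (f i) r n

/-- The canonical `R`-linear map `N ⊗[k] (I → k) → (I → N)`, `n ⊗ f ↦ (i ↦ f i • n)`. -/
def piHom : N ⊗[k] (I → k) →ₗ[R] (I → N) :=
  TensorProduct.AlgebraTensorModule.lift piBilin

/-- `piHom (n ⊗ f) i = f i • n`. -/
@[simp] theorem piHom_tmul (n : N) (f : I → k) (i : I) : piHom (R := R) (n ⊗ₜ[k] f) i = f i • n :=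
  rfl

variable {J : Type*} [Fintype J] (b : Module.Basis J k N)

omit [Algebra k R] [IsScalarTower k R N] in
/-- The inverse of `piHom` given a finite basis `b` of `N`: `g ↦ Σ_j b j ⊗ (i ↦ b.repr (g i) j)`. -/
def piInv (g : I → N) : N ⊗[k] (I → k) :=
  ∑ j, b j ⊗ₜ[k] (fun i => b.repr (g i) j)

/-- `piHom ∘ piInv = id`. -/
theorem piHom_piInv (g : I → N) : piHom (R := R) (piInv b g) = g := by
  ext i
  simp only [piInv, map_sum, Finset.sum_apply, piHom_tmul]
  exact b.sum_repr (g i)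

/-- `piInv ∘ piHom = id`. -/
theorem piInv_piHom (x : N ⊗[k] (I → k)) : piInv b (piHom (R := R) x) = x := by
  induction x using TensorProduct.induction_on with
  | zero =>
    simp only [piInv, map_zero, Pi.zero_apply, Finsupp.coe_zero]
    rw [show (fun _ : I => (0 : k)) = 0 from rfl]
    simp only [tmul_zero, Finset.sum_const_zero]
  | tmul n f =>
    have h1 : ∀ j, (fun i => b.repr (piHom (R := R) (n ⊗ₜ[k] f) i) j) = b.repr n j • f := by
      intro j
      ext i
      simp only [piHom_tmul, map_smul, Finsupp.smul_apply, smul_eq_mul, Pi.smul_apply, mul_comm]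
    simp only [piInv, h1, tmul_smul, smul_tmul', ← sum_tmul, b.sum_repr]
  | add x y hx hy =>
    have h2 : ∀ j, (fun i => b.repr (piHom (R := R) (x + y) i) j) =
        (fun i => b.repr (piHom (R := R) x i) j) + (fun i => b.repr (piHom (R := R) y i) j) := by
      intro j
      ext i
      simp only [map_add, Pi.add_apply, Finsupp.add_apply]
    simp only [piInv, h2, tmul_add, Finset.sum_add_distrib] at hx hy ⊢
    rw [hx, hy]

include b in
/-- `piHom` is bijective when `N` has a finite basis. -/
theorem piHom_bijective : Function.Bijective (piHom (k := k) (R := R) (N := N) (I := I)) :=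
  Function.bijective_iff_has_inverse.mpr ⟨piInv b, piInv_piHom b, piHom_piInv b⟩

/-- **`N ⊗ (I → k) ≃ (I → N)` for finite-dimensional `N`**, `R`-linearly, any index set `I`. -/
def piEquiv [FiniteDimensional k N] : N ⊗[k] (I → k) ≃ₗ[R] (I → N) :=
  LinearEquiv.ofBijective piHom (piHom_bijective (Module.finBasis k N))

end Pi

section Tensor

variable {W : Type*} [AddCommGroup W] [Module k W]

/-- `N ⊗[k] W ≃ₗ[R] (B →₀ N)` for a basis `B` of `W` (`R` acting through `N`). -/
def tensorFinsuppEquiv {B : Type*} [DecidableEq B] (bW : Module.Basis B k W) :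
    N ⊗[k] W ≃ₗ[R] (B →₀ N) :=
  (TensorProduct.AlgebraTensorModule.congr (LinearEquiv.refl R N) bW.repr).trans
    (finsuppScalarRight k R N B)

/-- `N ⊗[k] W` is semisimple over `R` when `N` is simple. -/
theorem isSemisimpleModule_tensor [IsSimpleModule R N] : IsSemisimpleModule R (N ⊗[k] W) := by
  classical
  haveI := isSemisimpleModule_finsupp (R := R) (N := N) (ι := Module.Basis.ofVectorSpaceIndex k W)
  exact IsSemisimpleModule.congr (tensorFinsuppEquiv (Module.Basis.ofVectorSpace k W))

/-- `N ⊗[k] W` is isotypic of type `N` when `N` is simple. -/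
theorem isIsotypicOfType_tensor [IsSimpleModule R N] : IsIsotypicOfType R (N ⊗[k] W) N := by
  classical
  exact (tensorFinsuppEquiv (R := R) (Module.Basis.ofVectorSpace k W)).isIsotypicOfType_iff.mpr
    isIsotypicOfType_finsupp

end Tensor

section Product

variable (k) {I : Type*} [IsSimpleModule R N] [FiniteDimensional k N]

include k

/-- A product of copies of a finite-dimensional simple `N` is semisimple. -/
theorem isSemisimpleModule_pi : IsSemisimpleModule R (I → N) := by
  haveI := isSemisimpleModule_tensor (k := k) (R := R) (N := N) (W := I → k)
  exact IsSemisimpleModule.congr (piEquiv (k := k) (R := R) (N := N) (I := I)).symm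

/-- A product of copies of a finite-dimensional simple `N` is isotypic of type `N`. -/
theorem isIsotypicOfType_pi : IsIsotypicOfType R (I → N) N :=
  (piEquiv (k := k) (R := R) (N := N) (I := I)).isIsotypicOfType_iff.mp
    (isIsotypicOfType_tensor (k := k) (W := I → k))

/-- **Submodules of products.** Every `R`-submodule of `I → N` is semisimple. -/
theorem isSemisimpleModule_of_le_pi (T : Submodule R (I → N)) : IsSemisimpleModule R T := by
  haveI := isSemisimpleModule_pi k (R := R) (N := N) (I := I)
  infer_instance

/-- **Submodules of products.** Every `R`-submodule of `I → N` is isotypic of type `N`. -/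
theorem isIsotypicOfType_of_le_pi (T : Submodule R (I → N)) : IsIsotypicOfType R T N :=
  (isIsotypicOfType_pi k (R := R) (N := N) (I := I)).of_injective T.subtype T.subtype_injective

/-- More generally, any module injecting `R`-linearly into `I → N` is semisimple. -/
theorem isSemisimpleModule_of_injective {T : Type*} [AddCommGroup T] [Module R T]
    (φ : T →ₗ[R] (I → N)) (hφ : Function.Injective φ) : IsSemisimpleModule R T := by
  haveI := isSemisimpleModule_of_le_pi k (LinearMap.range φ)
  exact IsSemisimpleModule.congr (LinearEquiv.ofInjective φ hφ)

/-- More generally, any module injecting `R`-linearly into `I → N` is isotypic of type `N`. -/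
theorem isIsotypicOfType_of_injective {T : Type*} [AddCommGroup T] [Module R T]
    (φ : T →ₗ[R] (I → N)) (hφ : Function.Injective φ) : IsIsotypicOfType R T N :=
  (isIsotypicOfType_pi k (R := R) (N := N) (I := I)).of_injective φ hφ

end Product

section IsotypicQuotient

variable (R N) (S : Type*) [AddCommGroup S] [Module R S]

omit [Field k] [Algebra k R] [Module k N] [IsScalarTower k R N] in
/-- `S(N) := ⋂_{f : S → N} Ker f` — MVW's `S(π₁)`. -/
def isotypicKer : Submodule R S := ⨅ f : S →ₗ[R] N, LinearMap.ker f

omit [Field k] [Algebra k R] [Module k N] [IsScalarTower k R N] in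
/-- Evaluation of all `R`-maps `S → N` at once: `s ↦ (f ↦ f s)`. -/
def evalAll : S →ₗ[R] ((S →ₗ[R] N) → N) := LinearMap.pi fun f => f

omit [Field k] [Algebra k R] [Module k N] [IsScalarTower k R N] in
/-- The kernel of `evalAll` is `S(N)`. -/
theorem ker_evalAll : LinearMap.ker (evalAll R N S) = isotypicKer R N S := by
  ext s
  simp only [evalAll, LinearMap.mem_ker, LinearMap.pi_apply, isotypicKer, Submodule.mem_iInf,
    funext_iff, Pi.zero_apply]

omit [Field k] [Algebra k R] [Module k N] [IsScalarTower k R N] in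
/-- `S[N] = S ⧸ S(N)` embeds into the product `Hom_R(S, N) → N`. -/
def quotEmbed : (S ⧸ isotypicKer R N S) →ₗ[R] ((S →ₗ[R] N) → N) :=
  (isotypicKer R N S).liftQ (evalAll R N S) (ker_evalAll R N S).symm.le

omit [Field k] [Algebra k R] [Module k N] [IsScalarTower k R N] in
/-- The embedding `S[N] → (Hom_R(S, N) → N)` is injective. -/
theorem quotEmbed_injective : Function.Injective (quotEmbed R N S) :=
  LinearMap.ker_eq_bot.mp
    (Submodule.ker_liftQ_eq_bot' (isotypicKer R N S) (evalAll R N S) (ker_evalAll R N S).symm)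

variable (k) [IsSimpleModule R N] [FiniteDimensional k N]

include k in
/-- **MVW III.5, `K`-level.** For a finite-dimensional simple `N`, the quotient `S[N] = S ⧸ S(N)`
is semisimple. -/
theorem isSemisimpleModule_isotypicQuot : IsSemisimpleModule R (S ⧸ isotypicKer R N S) :=
  isSemisimpleModule_of_injective k (quotEmbed R N S) (quotEmbed_injective R N S)

include k in
/-- **MVW III.5, `K`-level.** For a finite-dimensional simple `N`, `S[N]` is isotypic of type
`N`. -/
theorem isIsotypicOfType_isotypicQuot : IsIsotypicOfType R (S ⧸ isotypicKer R N S) N :=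
  isIsotypicOfType_of_injective k (quotEmbed R N S) (quotEmbed_injective R N S)

variable [Module k S] [IsScalarTower k R S]

/-- **MVW III.3 + III.5, `K`-level.** For a finite-dimensional simple `N` with `End_R(N) = k`
(Schur), `S[N] ≃ₗ[R] N ⊗[k] Hom_R(N, S[N])` by evaluation (`T5IsotypicHom.evEquiv`). -/
def isotypicQuotEquiv [Nontrivial N] (hSchur : ∀ φ : N →ₗ[R] N, ∃ c : k, ∀ x, φ x = c • x) :
    N ⊗[k] (N →ₗ[R] (S ⧸ isotypicKer R N S)) ≃ₗ[R] (S ⧸ isotypicKer R N S) :=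
  haveI := isSemisimpleModule_isotypicQuot k R N S
  T5IsotypicHom.evEquiv hSchur (isIsotypicOfType_isotypicQuot k R N S)

/-- `isotypicQuotEquiv (n ⊗ f) = f n`. -/
theorem isotypicQuotEquiv_tmul [Nontrivial N]
    (hSchur : ∀ φ : N →ₗ[R] N, ∃ c : k, ∀ x, φ x = c • x) (n : N)
    (f : N →ₗ[R] (S ⧸ isotypicKer R N S)) :
    isotypicQuotEquiv k R N S hSchur (n ⊗ₜ[k] f) = f n :=
  rfl

end IsotypicQuotient

end Summit.Ventures.HodgeRepro2.T5IsotypicProduct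

end
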